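import Summits.HubbardSuperconductivity.HubbardSuperconductivity.Theorems.BirComplexStableXY.Negative.WitnessTable
import HarnessLib

/-!
# Crux `BirComplexStableXYR` (stmt-HubbardSuperconductivity-14845): (R)∧(P) ⇒ the Gaussian part of the
# summed action is REAL, and (U1) ⇒ its linear part vanishes — for the crux's literal hypotheses

Support file (prover seat 0, route BalabanIR) for the restated engine
`…Theses.BalabanIR.BirComplexStableXYR`.  The standing disprover's abstract lemma
`Theorems.BirComplexStableXYR.Negative.quadForm_eq_zero_of_odd_even` says that a translation-invariant
real quadratic form on the torus which is odd under one map and even under another whose composite is a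
point inversion vanishes.  Here is the CONCRETE instance both positive idea cards
(`Cruxes/BirComplexStableXYR/Ideas/log-concave-core-bounded-phase.md`, `…/real-covariance-multiscale-port.md`)
invoke, stated for the crux's own data: a finite Fourier table `c` on the window `W_r`
(vocabulary of `Theorems.BirComplexStableXY.Negative.WitnessTable`) with, VERBATIM as in the crux,

  (R) `∀ n, c (fun w => n (w.1, w.2.1, Fin.rev w.2.2)) = conj (c (-n))`   (time-reflection Hermiticity),
  (P) `∀ n, c (fun w => n (Fin.rev w.1, Fin.rev w.2.1, w.2.2)) = c n`     (inversion evenness).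

* `gaussianReality` — for every real field `θ` on `(ℤ/L)² × ℤ/M`:
  `Im Σ_s Σ_n c_n (n·θ_s)² = 0`, `θ_s = θ ∘ sh s` — the quadratic Taylor term of the translate-summed
  action at the constants is real (no Gaussian sign problem; real spin-wave covariance).
  Proof: the point inversion `θ ↦ θ∘neg` leaves the form invariant by translation invariance alone
  (`greal_quad_neg_eq`: autocorrelations are even) and NEGATES it by (R)∧(P) (`greal_quad_neg_eq_neg`:
  `sh (-s-d⋆) (ιw) = -sh s w` for the full window inversion `ι = P∘R`, `greal_sh_inv`, and
  `c_{n∘ι} = conj c_{-n}`, `greal_table_inv`, reindexing the table by `n ↦ -(n∘ι)`).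
* `greal_linear_sum_eq_zero` — (U1) (charge-neutral support) ⇒ `Σ_s Σ_n c_n (n·θ_s) = 0`.

With `…BoundedPhase` (`‖F - quadratic Taylor polynomial‖ ≤ 2·normA·osc³`) this is the cards'
REGROUPING of the summed action on the small-oscillation core: `Σ_s F_s = -½·(real quadratic form) +
Σ_s u_s`, all non-Gaussian content in the cubically small `u_s`.  No hypothesis on `L, M` versus `r` is
needed (wrap-around is harmless for these identities). [folklore]
-/

noncomputable section

namespace Summit.HubbardSuperconductivity.HubbardSuperconductivity.Theorems

open scoped BigOperators ComplexConjugate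
open Summit.HubbardSuperconductivity.BirComplexStableXYNegative

section GaussianReality

variable {r : ℕ} {L M : ℕ} [NeZero L] [NeZero M]

/-- Autocorrelations along the translates are inversion invariant:
`Σ_s θ(-sh s w) θ(-sh s w') = Σ_s θ(sh s w) θ(sh s w')`. [folklore] -/
theorem greal_autocorr_neg (θ : Λ L M → ℝ) (w w' : W r) :
    ∑ s : Λ L M, θ (-(sh L M s w)) * θ (-(sh L M s w')) =
      ∑ s : Λ L M, θ (sh L M s w) * θ (sh L M s w') := by
  set d : W r → Λ L M := fun u => (![((u.1 : ℕ) : ZMod L), ((u.2.1 : ℕ) : ZMod L)], ((u.2.2 : ℕ) : ZMod M))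
    with hd
  have hsh : ∀ (s : Λ L M) (u : W r), sh L M s u = s + d u := fun s u => rfl
  simp only [hsh]
  -- both sides are the autocorrelation at lag `±(d w' - d w)`
  have hL : ∑ s : Λ L M, θ (-(s + d w)) * θ (-(s + d w')) =
      ∑ x : Λ L M, θ x * θ (x + (d w - d w')) := by
    rw [← Equiv.sum_comp (Equiv.subLeft (-(d w)))]
    refine Finset.sum_congr rfl fun x _ => ?_
    simp only [Equiv.subLeft_apply]
    congr 1 <;> congr 1 <;> abel
  have hR : ∑ s : Λ L M, θ (s + d w) * θ (s + d w') =
      ∑ x : Λ L M, θ x * θ (x + (d w' - d w)) := by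
    rw [← Equiv.sum_comp (Equiv.subRight (d w))]
    refine Finset.sum_congr rfl fun x _ => ?_
    simp only [Equiv.subRight_apply]
    congr 1 <;> congr 1 <;> abel
  have hC : ∑ x : Λ L M, θ x * θ (x + (d w - d w')) = ∑ x : Λ L M, θ x * θ (x + (d w' - d w)) := by
    rw [← Equiv.sum_comp (Equiv.addRight (d w' - d w))]
    refine Finset.sum_congr rfl fun x _ => ?_
    simp only [Equiv.coe_addRight]
    rw [mul_comm]
    congr 2
    abel
  rw [hL, hC, ← hR]

/-- Expanding the square of a window pairing summed over translates. [folklore] -/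
theorem greal_sum_sq_expand (n : Freq r) (g : Λ L M → W r → ℝ) :
    ∑ s : Λ L M, (∑ w, (n w : ℝ) * g s w) ^ 2 =
      ∑ w, ∑ w', (n w : ℝ) * (n w' : ℝ) * ∑ s : Λ L M, g s w * g s w' := by
  have h1 : ∀ s : Λ L M, (∑ w, (n w : ℝ) * g s w) ^ 2 =
      ∑ w, ∑ w', (n w : ℝ) * (n w' : ℝ) * (g s w * g s w') := by
    intro s
    rw [sq, Finset.sum_mul_sum]
    exact Finset.sum_congr rfl fun w _ => Finset.sum_congr rfl fun w' _ => by ring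
  simp only [h1]
  rw [Finset.sum_comm]
  refine Finset.sum_congr rfl fun w _ => ?_
  rw [Finset.sum_comm]
  refine Finset.sum_congr rfl fun w' _ => ?_
  rw [Finset.mul_sum]

/-- **Inversion invariance of the summed quadratic form** (translation invariance alone):
`Σ_n Im c_n Σ_s (n·(θ∘neg)_s)² = Σ_n Im c_n Σ_s (n·θ_s)²`. [folklore] -/
theorem greal_quad_neg_eq (c : Table r) (θ : Λ L M → ℝ) :
    ∑ n ∈ c.support, (c n).im * ∑ s : Λ L M, (∑ w, (n w : ℝ) * θ (-(sh L M s w))) ^ 2 =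
      ∑ n ∈ c.support, (c n).im * ∑ s : Λ L M, (∑ w, (n w : ℝ) * θ (sh L M s w)) ^ 2 := by
  refine Finset.sum_congr rfl fun n _ => ?_
  congr 1
  rw [greal_sum_sq_expand n (fun s w => θ (-(sh L M s w))),
    greal_sum_sq_expand n (fun s w => θ (sh L M s w))]
  refine Finset.sum_congr rfl fun w _ => Finset.sum_congr rfl fun w' _ => ?_
  rw [greal_autocorr_neg θ w w']

omit [NeZero L] [NeZero M] in
/-- The full space-time inversion of the window, `ι(a,b,t) = (r-1-a, r-1-b, r-1-t)`, intertwines the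
window shift with the point inversion of the torus: `sh (-s - d⋆) (ι w) = -(sh s w)` with
`d⋆ = ((r-1, r-1), r-1)`. [folklore] -/
theorem greal_sh_inv (s : Λ L M) (w : W r) :
    sh L M (-s - (![((r : ℕ) : ZMod L) - 1, ((r : ℕ) : ZMod L) - 1], ((r : ℕ) : ZMod M) - 1))
        (Fin.rev w.1, Fin.rev w.2.1, Fin.rev w.2.2) = -(sh L M s w) := by
  obtain ⟨a, b, t⟩ := w
  have ha : (((Fin.rev a : Fin r) : ℕ) : ZMod L) = ((r : ℕ) : ZMod L) - 1 - ((a : ℕ) : ZMod L) := by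
    rw [Fin.val_rev, Nat.cast_sub (by omega), Nat.cast_add, Nat.cast_one]; ring
  have hb : (((Fin.rev b : Fin r) : ℕ) : ZMod L) = ((r : ℕ) : ZMod L) - 1 - ((b : ℕ) : ZMod L) := by
    rw [Fin.val_rev, Nat.cast_sub (by omega), Nat.cast_add, Nat.cast_one]; ring
  have ht : (((Fin.rev t : Fin r) : ℕ) : ZMod M) = ((r : ℕ) : ZMod M) - 1 - ((t : ℕ) : ZMod M) := by
    rw [Fin.val_rev, Nat.cast_sub (by omega), Nat.cast_add, Nat.cast_one]; ring
  unfold sh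
  simp only [ha, hb, ht, Prod.neg_mk, Prod.fst_sub, Prod.snd_sub, Prod.fst_neg, Prod.snd_neg]
  refine Prod.ext ?_ ?_
  · ext i
    fin_cases i <;> simp <;> ring
  · simp only
    ring

omit [NeZero L] [NeZero M] in
/-- The pairing of the inverted field: `n·(θ∘neg)_s = (n∘ι)·θ_{-s-d⋆}`. [folklore] -/
theorem greal_frq_neg (n : Freq r) (θ : Λ L M → ℝ) (s : Λ L M) :
    ∑ w, (n w : ℝ) * θ (-(sh L M s w)) =
      ∑ w, ((n (Fin.rev w.1, Fin.rev w.2.1, Fin.rev w.2.2) : ℤ) : ℝ) *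
        θ (sh L M (-s - (![((r : ℕ) : ZMod L) - 1, ((r : ℕ) : ZMod L) - 1], ((r : ℕ) : ZMod M) - 1)) w) := by
  -- reindex `w ↦ ι w` (an involution)
  set ι : W r → W r := fun w => (Fin.rev w.1, Fin.rev w.2.1, Fin.rev w.2.2) with hι
  have hinv : Function.Involutive ι := fun w => by simp [hι, Fin.rev_rev]
  rw [← Equiv.sum_comp hinv.toPerm]
  refine Finset.sum_congr rfl fun w _ => ?_
  simp only [Function.Involutive.coe_toPerm]
  rw [← greal_sh_inv s (ι w)]
  simp only [hι, Fin.rev_rev]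

/-- (R)∧(P) as one identity: `c_{n∘ι} = conj c_{-n}` for the full inversion `ι = P ∘ R`. [folklore] -/
theorem greal_table_inv (c : Table r)
    (hR : ∀ n : Freq r, c (fun w => n (w.1, w.2.1, Fin.rev w.2.2)) = conj (c (-n)))
    (hP : ∀ n : Freq r, c (fun w => n (Fin.rev w.1, Fin.rev w.2.1, w.2.2)) = c n) (n : Freq r) :
    c (fun w => n (Fin.rev w.1, Fin.rev w.2.1, Fin.rev w.2.2)) = conj (c (-n)) := by
  have h1 := hR (fun w => n (Fin.rev w.1, Fin.rev w.2.1, w.2.2))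
  have h2 := hP (-n)
  have e : (fun w : W r => (-n) (Fin.rev w.1, Fin.rev w.2.1, w.2.2)) =
      -(fun w : W r => n (Fin.rev w.1, Fin.rev w.2.1, w.2.2)) := by
    funext w; simp
  rw [e] at h2
  rw [h2] at h1
  exact h1

/-- **Oddness of the summed quadratic form under inversion, from (R)∧(P)**:
`Σ_n Im c_n Σ_s (n·(θ∘neg)_s)² = -Σ_n Im c_n Σ_s (n·θ_s)²`. [folklore] -/
theorem greal_quad_neg_eq_neg (c : Table r)
    (hR : ∀ n : Freq r, c (fun w => n (w.1, w.2.1, Fin.rev w.2.2)) = conj (c (-n)))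
    (hP : ∀ n : Freq r, c (fun w => n (Fin.rev w.1, Fin.rev w.2.1, w.2.2)) = c n)
    (θ : Λ L M → ℝ) :
    ∑ n ∈ c.support, (c n).im * ∑ s : Λ L M, (∑ w, (n w : ℝ) * θ (-(sh L M s w))) ^ 2 =
      -∑ n ∈ c.support, (c n).im * ∑ s : Λ L M, (∑ w, (n w : ℝ) * θ (sh L M s w)) ^ 2 := by
  classical
  set ι : W r → W r := fun w => (Fin.rev w.1, Fin.rev w.2.1, Fin.rev w.2.2) with hι
  set dstar : Λ L M := (![((r : ℕ) : ZMod L) - 1, ((r : ℕ) : ZMod L) - 1], ((r : ℕ) : ZMod M) - 1)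
    with hdstar
  -- `Y m := Σ_s (m·θ_s)²` is even in `m`
  set Y : Freq r → ℝ := fun m => ∑ s : Λ L M, (∑ w, (m w : ℝ) * θ (sh L M s w)) ^ 2 with hY
  have hYneg : ∀ m : Freq r, Y (-m) = Y m := by
    intro m
    simp only [hY]
    refine Finset.sum_congr rfl fun s _ => ?_
    have : ∑ w, ((-m) w : ℝ) * θ (sh L M s w) = -∑ w, (m w : ℝ) * θ (sh L M s w) := by
      rw [← Finset.sum_neg_distrib]
      exact Finset.sum_congr rfl fun w _ => by simp
    rw [this, neg_sq]
  -- Step 1: the inverted field's form is `Σ_n Im c_n · Y (n∘ι)`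
  have hstep1 : ∀ n : Freq r, ∑ s : Λ L M, (∑ w, (n w : ℝ) * θ (-(sh L M s w))) ^ 2 =
      Y (fun w => n (ι w)) := by
    intro n
    simp only [hY]
    rw [← Equiv.sum_comp (Equiv.subLeft (-dstar))]
    refine Fintype.sum_congr _ _ fun s => ?_
    simp only [Equiv.subLeft_apply]
    rw [greal_frq_neg n θ (-dstar - s), ← hdstar]
    have e : -(-dstar - s) - dstar = s := by abel
    rw [e]
  simp only [hstep1]
  -- Step 2: reindex `n ↦ -(n∘ι)` on the support, using `c_{-(m∘ι)} = conj c_m`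
  have hkey : ∀ m : Freq r, c (fun w => -m (ι w)) = conj (c m) := by
    intro m
    have := greal_table_inv c hR hP (-m)
    simp only [Pi.neg_apply, neg_neg] at this
    simpa [hι] using this
  have hmem : ∀ m ∈ c.support, (fun w => -m (ι w)) ∈ c.support := by
    intro m hm
    rw [Finsupp.mem_support_iff] at hm ⊢
    rw [hkey m]
    exact fun h => hm (by simpa using congrArg conj h)
  have hinvol : ∀ m : Freq r, (fun w => -(fun w' => -m (ι w')) (ι w)) = m := by
    intro m; funext w; simp [hι, Fin.rev_rev]
  rw [← Finset.sum_neg_distrib]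
  symm
  refine Finset.sum_nbij' (fun m => fun w => -m (ι w)) (fun m => fun w => -m (ι w)) hmem hmem
    (fun m _ => hinvol m) (fun m _ => hinvol m) ?_
  intro m _
  rw [hkey m, Complex.conj_im]
  have e : (fun w => (fun w' => -m (ι w')) (ι w)) = -m := by
    funext w; simp [hι, Fin.rev_rev]
  rw [e, hYneg]
  ring

/-- **No Gaussian sign problem under (R)∧(P) — concrete form for the crux's hypotheses.**  For a
finite Fourier table `c` on the window `W_r` with the time-reflection Hermiticity (R)
`c_{n∘R} = conj c_{-n}` and the inversion evenness (P) `c_{n∘P} = c_n` (verbatim the crux's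
hypotheses), the quadratic Taylor term of the translate-summed action at the constants is REAL for
every real field `θ` on `(ℤ/L)² × ℤ/M`:
`Im Σ_s Σ_n c_n (n·θ_s)² = 0`, `θ_s = θ ∘ sh s`.  (Inversion `θ ↦ θ∘neg` leaves the form invariant
by translation invariance, `greal_quad_neg_eq`, and negates it by (R)∧(P), `greal_quad_neg_eq_neg`;
the abstract kernel version is `Negative.quadForm_eq_zero_of_odd_even`.) [folklore] -/
theorem gaussianReality (c : Table r)
    (hR : ∀ n : Freq r, c (fun w => n (w.1, w.2.1, Fin.rev w.2.2)) = conj (c (-n)))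
    (hP : ∀ n : Freq r, c (fun w => n (Fin.rev w.1, Fin.rev w.2.1, w.2.2)) = c n)
    (L M : ℕ) [NeZero L] [NeZero M] (θ : Λ L M → ℝ) :
    (∑ s : Λ L M, c.sum (fun n a =>
      a * (((∑ w, (n w : ℝ) * θ (sh L M s w)) ^ 2 : ℝ) : ℂ))).im = 0 := by
  classical
  have hq : (∑ s : Λ L M, c.sum (fun n a =>
      a * (((∑ w, (n w : ℝ) * θ (sh L M s w)) ^ 2 : ℝ) : ℂ))).im =
      ∑ n ∈ c.support, (c n).im * ∑ s : Λ L M, (∑ w, (n w : ℝ) * θ (sh L M s w)) ^ 2 := by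
    unfold Finsupp.sum
    simp only [Complex.im_sum]
    rw [Finset.sum_comm]
    refine Finset.sum_congr rfl fun n _ => ?_
    rw [Finset.mul_sum]
    refine Finset.sum_congr rfl fun s _ => ?_
    rw [Complex.mul_im, Complex.ofReal_re, Complex.ofReal_im, mul_zero, zero_add]
  rw [hq]
  have h1 := greal_quad_neg_eq c θ
  have h2 := greal_quad_neg_eq_neg c hR hP θ
  linarith

/-- **The summed linear Taylor term vanishes by (U1).**  For a table with charge-neutral support,
`Σ_s Σ_n c_n (n·θ_s) = 0` for every real field `θ` on the torus (each `Σ_s θ(sh s w) = Σ_x θ_x` is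
independent of `w`).  Together with `gaussianReality` and `…BoundedPhase` this is the regrouping of
the idea cards: `Σ_s F_s(θ) = -½ Σ_s Σ_n c_n (n·θ_s)²` (a REAL quadratic form) `+ Σ_s u_s(θ)` with
`‖u_s‖ ≤ 2·normA(c)·osc³`. [folklore] -/
theorem greal_linear_sum_eq_zero (c : Table r) (hU1 : ∀ n ∈ c.support, ∑ w, n w = 0)
    (L M : ℕ) [NeZero L] [NeZero M] (θ : Λ L M → ℝ) :
    ∑ s : Λ L M, c.sum (fun n a => a * ((∑ w, (n w : ℝ) * θ (sh L M s w) : ℝ) : ℂ)) = 0 := by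
  classical
  unfold Finsupp.sum
  rw [Finset.sum_comm]
  refine Finset.sum_eq_zero fun n hn => ?_
  rw [← Finset.mul_sum]
  have hsum : ∑ s : Λ L M, ((∑ w, (n w : ℝ) * θ (sh L M s w) : ℝ) : ℂ) = 0 := by
    rw [← Complex.ofReal_sum, Complex.ofReal_eq_zero, Finset.sum_comm]
    have hs : ∀ w : W r, ∑ s : Λ L M, (n w : ℝ) * θ (sh L M s w) = (n w : ℝ) * ∑ x : Λ L M, θ x := by
      intro w
      rw [Finset.mul_sum]
      set d : Λ L M := (![((w.1 : ℕ) : ZMod L), ((w.2.1 : ℕ) : ZMod L)], ((w.2.2 : ℕ) : ZMod M))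
        with hd
      have hsh : ∀ s : Λ L M, sh L M s w = s + d := fun s => rfl
      simp only [hsh]
      exact Equiv.sum_comp (Equiv.addRight d) (fun x => (n w : ℝ) * θ x)
    simp only [hs, ← Finset.sum_mul]
    have h0 : (∑ w, (n w : ℝ)) = 0 := by exact_mod_cast hU1 n hn
    rw [h0, zero_mul]
  rw [hsum, mul_zero]

end GaussianReality

end Summit.HubbardSuperconductivity.HubbardSuperconductivity.Theorems
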